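import Mathlib
import Literature.NumberTheory.Irrationality.LaiSprangZudilin2026.TwoAdicEstimate
import Literature.NumberTheory.Irrationality.LaiSprangZudilin2026.LemmaFiveThree
import Literature.NumberTheory.Irrationality.LaiSprangZudilin2026.IntegerSolution
import Literature.NumberTheory.Irrationality.PAdicZetaValues.Records
import Literature.NumberTheory.Irrationality.PAdicZetaValues.MeasureCriterion
import Literature.NumberTheory.Transcendental.ZetaLinearFormsCriterion
import HarnessLib

/-!
# Lai–Sprang–Zudilin 2026, Theorem 1.1: `ζ₂(5)` is irrational, `μ(ζ₂(5)) ≤ 16 log 2/(8 log 2 − 5)` — PROVED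

Topic `Literature/NumberTheory/Irrationality/LaiSprangZudilin2026`.  Source: L. Lai, J. Sprang, W. Zudilin, *A note on the
irrationality of `ζ₂(5)`*, IMRN **2026**:16, rnag180 = arXiv:2505.05005 [LaiSprangZudilin2026], §6 Lemma 6.1, §5 (eq:PNT) and
§7 "Proof of the main theorem" (held text `paper:arxiv-2505.05005`, chunks p0009–p0011, read on the page).  PROOF FILE: the
discharge **`PAdicZetaValues.laiSprangZudilin2026_theorem11_holds`** of the tree's named fact
`Literature.NumberTheory.Irrationality.PAdicZetaValues.laiSprangZudilin2026_theorem11` (`Records.lean`); file 4 of 4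
(`PAdicZetaValues/VolkenbornDeltaOperator.lean` = §2, `TwoAdicLinearForms.lean` = Lemma 3.3, `TwoAdicEstimate.lean` = Lemma 6.2).
No new definition of mathematical content beyond the printed `a_n`, `b_n`; no named fact (net debt −1).

## Source, as printed (§7)

"*Proof of Theorem 1.1.* For any `n ∈ ℤ_{>0}`, define `Ŝ_n := Π_n^{−1}d_n^6·S_n`.  By Lemma 3.3, Lemma 5.1 and Lemma 5.4 we have
`Ŝ_n = a_n + b_nζ₂(5)`, where `a_n = Π_n^{−1}d_n^6·ρ_{n,0} ∈ ℤ`, `b_n = Π_n^{−1}d_n^6·ρ_{n,3} ∈ ℤ`.  Furthermore, by Lemma 4.2 (b),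
`a_nb_{n+1} − a_{n+1}b_n ≠ 0` for all `n ∈ ℤ_{>0}`.  Note that `v₂(Π_n^{−1}d_n^6) = O(log n)` as `n → ∞`.  By Lemma 6.2, we
obtain `|Ŝ_n|₂ ≤ exp(−αn + o(n))` as `n → ∞`, where `α = 16 log 2`.  By Lemma 6.1 and Equations (5.3) [(eq:PNT):
`d_n = e^{n+o(n)}` and `Π_n = e^{n+o(n)}` as `n → ∞`], we have `max{|a_n|, |b_n|} ≤ exp(βn + o(n))` as `n → ∞`, where
`β = 8 log 2 + 5`.  Since `α > β > 0`, we conclude that `ζ₂(5)` is irrational.  Finally, from Lemma 2.3 [Bel's `p`-adic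
Nesterenko criterion] we deduce the estimate `μ(ζ₂(5)) ≤ α/(α−β) = 16 log 2/(8 log 2 − 5) = 20.342651…`."

"**Lemma 6.1.** We have `max{|ρ_{n,0}|, |ρ_{n,3}|} ≤ 2^{8n+o(n)}` as `n → ∞`.  *Proof.* By Lemma 4.2 both sequences of the
coefficients satisfy the same difference equation (eq:rec) whose characteristic polynomial `λ² − 2⁹λ + 2¹⁶` has double zero
`λ = 2⁸`.  By the classical Poincaré theorem we conclude that `limsup_{n→∞}|ρ_{n,i}|^{1/n} ≤ 2⁸` for both `i = 0, 3`."

## How it is formalised (the printed architecture, step by step)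

* §1 **Lemma 6.1** (`abs_recSol_le`, `eventually_abs_recSol_le_exp`): for every solution `y` of (eq:rec) and every `δ > 0`,
  `|y_n| ≤ C(256(1+δ))ⁿ`.  DEVIATION (Mathlib has no Poincaré–Perron theorem): instead of Poincaré's theorem we give the
  elementary proof adapted to the double root `2⁸` — with `w_n = y_n/256ⁿ` and `z_n = w_{n+1} − w_n`, (eq:rec) reads
  `z_{n+1} = ((n+1)/(n+2))⁵z_n + γ_n w_{n+1}` with `|γ_n| ≤ 3/(n+2)²` (`zq_succ`, `abs_gam_le`), and the weighted norm
  `V_n = |w_{n+1}| + K|z_n|` satisfies `V_{n+1} ≤ (1 + 1/K)(1 + 3(K+1)/(n+2)²)V_n` (`V_succ_le`), whence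
  `V_n ≤ V_0 (1+1/K)ⁿ e^{3(K+1)}` (`V_le`); this gives exactly the printed conclusion `limsup |y_n|^{1/n} ≤ 2⁸`.
* §2 **(eq:PNT)** from the prime number theorem of the tree (`Transcendental.tendsto_log_lcmUpto_div`: `log d_n/n → 1`;
  `LFunctions.chebyshevTheta_isEquivalent`: `θ(x) ~ x`): `d_n ≤ e^{(1+η)n}` and `Π_n ≥ e^{(1−η)n}` eventually
  (`eventually_lcmUpto_le_exp`, `eventually_exp_le_primeProd`; the latter through `primorial n ≤ Π_n · 4^{max{3,⌊√(2n)⌋}}`,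
  `primorial_le_primeProd_mul`), hence `Π_n^{−1}d_n^6 ≤ e^{(5+ε)n}` (`eventually_dPi_le_exp`); `Π_n ∣ d_n` (`primeProd_dvd_lcmUpto`).
* §3 **§7 as printed**: `dPi n = Π_n^{−1}d_n^6 ∈ ℕ`, `a_n = dPi n·ρ_{n,0} ∈ ℤ` (Lemma 5.4 = the tree's `lemma54`), `b_n = dPi n·ρ_{n,3} ∈ ℤ`
  (`exists_int_rho3`); `Ŝ_n = dPi n · S_n = a_n + b_nζ₂(5)` (`linearForm_eq`, from `lemma33`); `a_nb_{n+1} − a_{n+1}b_n ≠ 0`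
  (`det_ne_zero`, from `determinant_ne_zero` = Lemma 4.2 (b)); `‖Ŝ_n‖₂ ≤ ‖S_n‖₂ ≤ e^{−(16 log 2 − ε)n}` (`norm_S_le_exp` = Lemma 6.2;
  `‖dPi n‖₂ ≤ 1`); `max{|a_n|,|b_n|} ≤ e^{(8 log 2 + 5 + ε)n}` (§1, §2); and Bel's criterion in the tree's form
  `PAdicZetaValues.MeasureCriterion.bel_criterion` (= Lemma 2.3) with `α = 16 log 2 > β = 8 log 2 + 5 > 0`
  (`Real.log_two_gt_d9`), `α/(α − β) = 16 log 2/(8 log 2 − 5)`.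

Cell zeta5-irr / pub-zeta5 (HONEST FRAMING: systematic search; no irrationality claim unless kernel-certified): this file
kernel-certifies the PUBLISHED theorem "`ζ₂(5) ∉ ℚ`" of [LaiSprangZudilin2026] about the `2`-ADIC zeta value; it says nothing
about the real number `ζ(5)`.
-/

noncomputable section

open Filter Finset Topology Asymptotics
open Literature.NumberTheory.Irrationality.PAdicZetaValues

namespace Literature.NumberTheory.Irrationality.LaiSprangZudilin2026

/-! ## §1. Lemma 6.1: solutions of (eq:rec) grow at most like `2^{8n+o(n)}` -/

section Growth

variable (y₀ y₁ : ℚ)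

/-- `w_n = y_n/256ⁿ` (the solution rescaled by the double characteristic root `2⁸`).
[cite: LaiSprangZudilin2026, Lemma 6.1 (proof: "double zero `λ = 2⁸`")] -/
def wq (n : ℕ) : ℝ := (recSol y₀ y₁ n : ℝ) / 256 ^ n

/-- `z_n = w_{n+1} − w_n`. [cite: LaiSprangZudilin2026, Lemma 6.1 (proof)] -/
def zq (n : ℕ) : ℝ := wq y₀ y₁ (n + 1) - wq y₀ y₁ n

/-- `γ_n = −(24m³+36m²+22m+5)/(8(m+1)⁵)`, `m = n+1`: the defect of (eq:rec) from the constant-coefficient equation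
`w_{n+2} − 2w_{n+1} + w_n = 0`. [cite: LaiSprangZudilin2026, Lemma 6.1 (proof), §1 (eq:rec)] -/
def gam (n : ℕ) : ℝ :=
  -(24 * ((n : ℝ) + 1) ^ 3 + 36 * ((n : ℝ) + 1) ^ 2 + 22 * ((n : ℝ) + 1) + 5) / (8 * ((n : ℝ) + 2) ^ 5)

/-- The middle coefficient of (eq:rec) as a real polynomial. [cite: LaiSprangZudilin2026, §1 (eq:rec)] -/
theorem recMid_real (m : ℕ) :
    ((recMid m : ℕ) : ℝ) = 32 * (2 * (m : ℝ) + 1) * (8 * (m : ℝ) ^ 4 + 16 * (m : ℝ) ^ 3 + 20 * (m : ℝ) ^ 2 + 12 * m + 3) := by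
  simp only [recMid]
  push_cast
  ring

/-- (eq:rec) for `w_n`: `256(n+2)⁵w_{n+2} = recMid(n+1)·w_{n+1} − 256(n+1)⁵w_n`. [cite: LaiSprangZudilin2026, §1 (eq:rec)] -/
theorem wq_succ_succ (n : ℕ) :
    wq y₀ y₁ (n + 2) =
      (((recMid (n + 1) : ℕ) : ℝ) * wq y₀ y₁ (n + 1) / 256 - ((n : ℝ) + 1) ^ 5 * wq y₀ y₁ n) / ((n : ℝ) + 2) ^ 5 := by
  simp only [wq]
  rw [recSol_succ_succ]
  have h2 : ((n : ℝ) + 2) ≠ 0 := by positivity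
  have h3 : (256 : ℝ) ^ n ≠ 0 := by positivity
  have h4 : (256 : ℝ) ^ (n + 1) ≠ 0 := by positivity
  have h5 : (256 : ℝ) ^ (n + 2) ≠ 0 := by positivity
  push_cast
  field_simp
  ring

/-- **(eq:rec) in first-order form at the double root**: `z_{n+1} = ((n+1)/(n+2))⁵ z_n + γ_n w_{n+1}`.
[cite: LaiSprangZudilin2026, Lemma 6.1 (proof), §1 (eq:rec)] -/
theorem zq_succ (n : ℕ) :
    zq y₀ y₁ (n + 1) = (((n : ℝ) + 1) / ((n : ℝ) + 2)) ^ 5 * zq y₀ y₁ n + gam n * wq y₀ y₁ (n + 1) := by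
  simp only [zq, gam]
  rw [show n + 1 + 1 = n + 2 from rfl, wq_succ_succ, recMid_real]
  have h2 : ((n : ℝ) + 2) ≠ 0 := by positivity
  push_cast
  field_simp
  ring

/-- `|γ_n| ≤ 3/(n+2)²`. [cite: LaiSprangZudilin2026, Lemma 6.1 (proof)] -/
theorem abs_gam_le (n : ℕ) : |gam n| ≤ 3 / ((n : ℝ) + 2) ^ 2 := by
  have hn : (0 : ℝ) ≤ n := Nat.cast_nonneg n
  rw [gam, abs_div, abs_neg, abs_of_pos (by positivity), abs_of_pos (by positivity),
    div_le_div_iff₀ (by positivity) (by positivity)]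
  have hP : 24 * ((n : ℝ) + 1) ^ 3 + 36 * ((n : ℝ) + 1) ^ 2 + 22 * ((n : ℝ) + 1) + 5 ≤ 24 * ((n : ℝ) + 2) ^ 3 := by
    nlinarith [sq_nonneg (n : ℝ)]
  calc (24 * ((n : ℝ) + 1) ^ 3 + 36 * ((n : ℝ) + 1) ^ 2 + 22 * ((n : ℝ) + 1) + 5) * ((n : ℝ) + 2) ^ 2
        ≤ 24 * ((n : ℝ) + 2) ^ 3 * ((n : ℝ) + 2) ^ 2 := mul_le_mul_of_nonneg_right hP (by positivity)
    _ = 3 * (8 * ((n : ℝ) + 2) ^ 5) := by ring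

/-- The weighted norm `V_n = |w_{n+1}| + K|z_n|`. [cite: LaiSprangZudilin2026, Lemma 6.1 (proof)] -/
def V (K : ℝ) (n : ℕ) : ℝ := |wq y₀ y₁ (n + 1)| + K * |zq y₀ y₁ n|

/-- **The one-step estimate** `V_{n+1} ≤ (1 + 1/K)(1 + 3(K+1)/(n+2)²)·V_n` (`K ≥ 1`). [cite: LaiSprangZudilin2026, Lemma 6.1 (proof)] -/
theorem V_succ_le {K : ℝ} (hK : 1 ≤ K) (n : ℕ) :
    V y₀ y₁ K (n + 1) ≤ (1 + 1 / K) * (1 + 3 * (K + 1) / ((n : ℝ) + 2) ^ 2) * V y₀ y₁ K n := by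
  have hK0 : K ≠ 0 := by positivity
  set c : ℝ := 3 / ((n : ℝ) + 2) ^ 2 with hc
  have hc0 : 0 ≤ c := by positivity
  have hz : |zq y₀ y₁ (n + 1)| ≤ |zq y₀ y₁ n| + c * |wq y₀ y₁ (n + 1)| := by
    rw [zq_succ]
    refine (abs_add_le _ _).trans (add_le_add ?_ ?_)
    · rw [abs_mul, abs_of_nonneg (by positivity)]
      refine mul_le_of_le_one_left (abs_nonneg _) (pow_le_one₀ (by positivity) ?_)
      rw [div_le_one (by positivity)]
      linarith
    · rw [abs_mul]
      exact mul_le_mul_of_nonneg_right (abs_gam_le n) (abs_nonneg _)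
  have hw : |wq y₀ y₁ (n + 2)| ≤ |wq y₀ y₁ (n + 1)| + |zq y₀ y₁ (n + 1)| := by
    have e : wq y₀ y₁ (n + 2) = wq y₀ y₁ (n + 1) + zq y₀ y₁ (n + 1) := by simp only [zq]; ring
    rw [e]
    exact abs_add_le _ _
  simp only [V]
  rw [show n + 1 + 1 = n + 2 from rfl]
  set A := |wq y₀ y₁ (n + 1)|
  set Z := |zq y₀ y₁ n|
  set Z' := |zq y₀ y₁ (n + 1)|
  set A' := |wq y₀ y₁ (n + 2)|
  have hA : 0 ≤ A := abs_nonneg _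
  have hZ : 0 ≤ Z := abs_nonneg _
  have hF1 : 1 ≤ 1 + 1 / K := by
    have : 0 ≤ 1 / K := by positivity
    linarith
  have hF2 : 1 ≤ 1 + 3 * (K + 1) / ((n : ℝ) + 2) ^ 2 := by
    have : 0 ≤ 3 * (K + 1) / ((n : ℝ) + 2) ^ 2 := by positivity
    linarith
  have h3 : (K + 1) * Z' ≤ (K + 1) * (Z + c * A) := mul_le_mul_of_nonneg_left hz (by positivity)
  have h4 : (1 + 3 * (K + 1) / ((n : ℝ) + 2) ^ 2) * A ≤ (1 + 1 / K) * ((1 + 3 * (K + 1) / ((n : ℝ) + 2) ^ 2) * A) :=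
    le_mul_of_one_le_left (by positivity) hF1
  have h5 : (1 + 1 / K) * K * Z ≤ (1 + 3 * (K + 1) / ((n : ℝ) + 2) ^ 2) * ((1 + 1 / K) * K * Z) :=
    le_mul_of_one_le_left (by positivity) hF2
  calc A' + K * Z' ≤ (A + Z') + K * Z' := by linarith
    _ = A + (K + 1) * Z' := by ring
    _ ≤ A + (K + 1) * (Z + c * A) := by linarith
    _ = (1 + 3 * (K + 1) / ((n : ℝ) + 2) ^ 2) * A + (1 + 1 / K) * K * Z := by
        rw [hc]; field_simp; ring
    _ ≤ (1 + 1 / K) * ((1 + 3 * (K + 1) / ((n : ℝ) + 2) ^ 2) * A) +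
          (1 + 3 * (K + 1) / ((n : ℝ) + 2) ^ 2) * ((1 + 1 / K) * K * Z) := add_le_add h4 h5
    _ = (1 + 1 / K) * (1 + 3 * (K + 1) / ((n : ℝ) + 2) ^ 2) * (A + K * Z) := by ring

/-- `1/(n+2)² ≤ 1/(n+1) − 1/(n+2)` (telescoping majorant of `Σ 1/(n+2)²`). [folklore] -/
private theorem inv_sq_le_sub (n : ℕ) :
    1 / ((n : ℝ) + 2) ^ 2 ≤ 1 / ((n : ℝ) + 1) - 1 / ((n : ℝ) + 2) := by
  have hn : (0 : ℝ) ≤ n := Nat.cast_nonneg n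
  have e : 1 / ((n : ℝ) + 1) - 1 / ((n : ℝ) + 2) = 1 / (((n : ℝ) + 1) * ((n : ℝ) + 2)) := by
    field_simp; ring
  rw [e]
  exact one_div_le_one_div_of_le (by positivity) (by nlinarith)

/-- **The Grönwall bound** `V_n ≤ V_0 (1 + 1/K)ⁿ exp(3(K+1)(1 − 1/(n+1)))`. [cite: LaiSprangZudilin2026, Lemma 6.1 (proof)] -/
theorem V_le {K : ℝ} (hK : 1 ≤ K) (n : ℕ) :
    V y₀ y₁ K n ≤ V y₀ y₁ K 0 * (1 + 1 / K) ^ n * Real.exp (3 * (K + 1) * (1 - 1 / ((n : ℝ) + 1))) := by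
  have hV0 : 0 ≤ V y₀ y₁ K 0 := by simp only [V]; positivity
  have hF1 : 0 ≤ 1 + 1 / K := by positivity
  induction n with
  | zero => simp
  | succ n ih =>
    have step := V_succ_le y₀ y₁ hK n
    have hF2 : 1 + 3 * (K + 1) / ((n : ℝ) + 2) ^ 2 ≤ Real.exp (3 * (K + 1) / ((n : ℝ) + 2) ^ 2) := by
      have := Real.add_one_le_exp (3 * (K + 1) / ((n : ℝ) + 2) ^ 2); linarith
    have hexp : Real.exp (3 * (K + 1) / ((n : ℝ) + 2) ^ 2) * Real.exp (3 * (K + 1) * (1 - 1 / ((n : ℝ) + 1))) ≤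
        Real.exp (3 * (K + 1) * (1 - 1 / (((n + 1 : ℕ) : ℝ) + 1))) := by
      rw [← Real.exp_add, Real.exp_le_exp]
      have e2 : ((n + 1 : ℕ) : ℝ) + 1 = (n : ℝ) + 2 := by push_cast; ring
      rw [e2]
      have h := inv_sq_le_sub n
      have hK3 : (0 : ℝ) ≤ 3 * (K + 1) := by positivity
      have e3 : 3 * (K + 1) / ((n : ℝ) + 2) ^ 2 + 3 * (K + 1) * (1 - 1 / ((n : ℝ) + 1)) =
          3 * (K + 1) * (1 / ((n : ℝ) + 2) ^ 2 + (1 - 1 / ((n : ℝ) + 1))) := by ring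
      rw [e3]
      exact mul_le_mul_of_nonneg_left (by linarith) hK3
    have hX : 0 ≤ V y₀ y₁ K 0 * (1 + 1 / K) ^ n * Real.exp (3 * (K + 1) * (1 - 1 / ((n : ℝ) + 1))) :=
      mul_nonneg (mul_nonneg hV0 (pow_nonneg hF1 n)) (Real.exp_pos _).le
    calc V y₀ y₁ K (n + 1)
        ≤ (1 + 1 / K) * (1 + 3 * (K + 1) / ((n : ℝ) + 2) ^ 2) * V y₀ y₁ K n := step
      _ ≤ (1 + 1 / K) * (1 + 3 * (K + 1) / ((n : ℝ) + 2) ^ 2) *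
            (V y₀ y₁ K 0 * (1 + 1 / K) ^ n * Real.exp (3 * (K + 1) * (1 - 1 / ((n : ℝ) + 1)))) :=
          mul_le_mul_of_nonneg_left ih (by positivity)
      _ ≤ (1 + 1 / K) * Real.exp (3 * (K + 1) / ((n : ℝ) + 2) ^ 2) *
            (V y₀ y₁ K 0 * (1 + 1 / K) ^ n * Real.exp (3 * (K + 1) * (1 - 1 / ((n : ℝ) + 1)))) :=
          mul_le_mul_of_nonneg_right (mul_le_mul_of_nonneg_left hF2 hF1) hX
      _ = V y₀ y₁ K 0 * (1 + 1 / K) ^ (n + 1) *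
            (Real.exp (3 * (K + 1) / ((n : ℝ) + 2) ^ 2) * Real.exp (3 * (K + 1) * (1 - 1 / ((n : ℝ) + 1)))) := by ring
      _ ≤ V y₀ y₁ K 0 * (1 + 1 / K) ^ (n + 1) * Real.exp (3 * (K + 1) * (1 - 1 / (((n + 1 : ℕ) : ℝ) + 1))) :=
          mul_le_mul_of_nonneg_left hexp (mul_nonneg hV0 (pow_nonneg hF1 _))

/-- **Lemma 6.1 (for every solution of (eq:rec))**: for every `δ > 0` there is `C ≥ 0` with `|y_n| ≤ C·(2⁸(1+δ))ⁿ` for all `n`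
(i.e. `limsup |y_n|^{1/n} ≤ 2⁸`). [cite: LaiSprangZudilin2026, Lemma 6.1] -/
theorem abs_recSol_le {δ : ℝ} (hδ : 0 < δ) :
    ∃ C : ℝ, 0 ≤ C ∧ ∀ n : ℕ, |(recSol y₀ y₁ n : ℝ)| ≤ C * (256 * (1 + δ)) ^ n := by
  set K : ℝ := max 1 δ⁻¹ with hKdef
  have hK : 1 ≤ K := le_max_left _ _
  have hK0 : 0 < K := by positivity
  have hKδ : 1 + 1 / K ≤ 1 + δ := by
    have h1 : δ⁻¹ ≤ K := le_max_right _ _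
    have : 1 / K ≤ δ := by
      rw [one_div]
      exact (inv_le_comm₀ hK0 hδ).2 h1
    linarith
  have hV0 : 0 ≤ V y₀ y₁ K 0 := by simp only [V]; positivity
  set C₁ : ℝ := V y₀ y₁ K 0 * Real.exp (3 * (K + 1)) with hC₁
  refine ⟨max |wq y₀ y₁ 0| C₁, (abs_nonneg _).trans (le_max_left _ _), fun n => ?_⟩
  have hy : |(recSol y₀ y₁ n : ℝ)| = 256 ^ n * |wq y₀ y₁ n| := by
    rw [wq, abs_div, abs_of_pos (by positivity : (0 : ℝ) < 256 ^ n), mul_div_cancel₀ _ (by positivity)]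
  suffices hw : |wq y₀ y₁ n| ≤ max |wq y₀ y₁ 0| C₁ * (1 + δ) ^ n by
    calc |(recSol y₀ y₁ n : ℝ)| = 256 ^ n * |wq y₀ y₁ n| := hy
      _ ≤ 256 ^ n * (max |wq y₀ y₁ 0| C₁ * (1 + δ) ^ n) := mul_le_mul_of_nonneg_left hw (by positivity)
      _ = max |wq y₀ y₁ 0| C₁ * (256 * (1 + δ)) ^ n := by rw [mul_pow]; ring
  cases n with
  | zero => simp only [pow_zero, mul_one]; exact le_max_left _ _
  | succ m =>
    have hwV : |wq y₀ y₁ (m + 1)| ≤ V y₀ y₁ K m := by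
      simp only [V]
      have : 0 ≤ K * |zq y₀ y₁ m| := by positivity
      linarith
    have hE : Real.exp (3 * (K + 1) * (1 - 1 / ((m : ℝ) + 1))) ≤ Real.exp (3 * (K + 1)) := by
      rw [Real.exp_le_exp]
      have h1 : 0 ≤ 1 / ((m : ℝ) + 1) := by positivity
      have h2 : (0 : ℝ) ≤ 3 * (K + 1) := by positivity
      nlinarith
    have hC0 : 0 ≤ max |wq y₀ y₁ 0| C₁ := (abs_nonneg _).trans (le_max_left _ _)
    calc |wq y₀ y₁ (m + 1)| ≤ V y₀ y₁ K m := hwV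
      _ ≤ V y₀ y₁ K 0 * (1 + 1 / K) ^ m * Real.exp (3 * (K + 1) * (1 - 1 / ((m : ℝ) + 1))) := V_le y₀ y₁ hK m
      _ ≤ V y₀ y₁ K 0 * (1 + δ) ^ m * Real.exp (3 * (K + 1)) :=
          mul_le_mul (mul_le_mul_of_nonneg_left (pow_le_pow_left₀ (by positivity) hKδ m) hV0) hE
            (Real.exp_pos _).le (mul_nonneg hV0 (by positivity))
      _ = C₁ * (1 + δ) ^ m := by rw [hC₁]; ring
      _ ≤ max |wq y₀ y₁ 0| C₁ * (1 + δ) ^ (m + 1) :=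
          mul_le_mul (le_max_right _ _) (pow_le_pow_right₀ (by linarith) (by omega)) (by positivity) hC0

/-- `exp(8 log 2) = 256`. [folklore] -/
private theorem exp_eight_log_two : Real.exp (8 * Real.log 2) = 256 := by
  have h : (8 : ℝ) * Real.log 2 = Real.log ((2 : ℝ) ^ 8) := by rw [Real.log_pow]; norm_num
  rw [h, Real.exp_log (by norm_num)]
  norm_num

/-- **Lemma 6.1, exponential form**: for every `ε > 0`, eventually `|y_n| ≤ exp((8 log 2 + ε)n)`.
[cite: LaiSprangZudilin2026, Lemma 6.1] -/
theorem eventually_abs_recSol_le_exp {ε : ℝ} (hε : 0 < ε) :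
    ∀ᶠ n : ℕ in atTop, |(recSol y₀ y₁ n : ℝ)| ≤ Real.exp ((8 * Real.log 2 + ε) * n) := by
  obtain ⟨C, hC0, hC⟩ := abs_recSol_le y₀ y₁ (half_pos hε)
  have hCev : ∀ᶠ n : ℕ in atTop, C ≤ Real.exp (ε / 2 * n) :=
    (Real.tendsto_exp_atTop.comp ((tendsto_natCast_atTop_atTop (R := ℝ)).const_mul_atTop (half_pos hε))).eventually_ge_atTop C
  filter_upwards [hCev] with n hn
  have h256 : (256 : ℝ) * (1 + ε / 2) ≤ Real.exp (8 * Real.log 2 + ε / 2) := by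
    rw [Real.exp_add, exp_eight_log_two]
    have := Real.add_one_le_exp (ε / 2)
    gcongr
    linarith
  calc |(recSol y₀ y₁ n : ℝ)| ≤ C * (256 * (1 + ε / 2)) ^ n := hC n
    _ ≤ Real.exp (ε / 2 * n) * Real.exp (8 * Real.log 2 + ε / 2) ^ n :=
        mul_le_mul hn (pow_le_pow_left₀ (by positivity) h256 n) (by positivity) (by positivity)
    _ = Real.exp ((8 * Real.log 2 + ε) * n) := by
        rw [← Real.exp_nat_mul, ← Real.exp_add]
        congr 1
        ring

end Growth

/-! ## §2. (eq:PNT): `d_n = e^{n+o(n)}`, `Π_n = e^{n+o(n)}`, and `Π_n ∣ d_n` -/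

/-- `d_n ≤ e^{(1+η)n}` eventually (prime number theorem; tree: `tendsto_log_lcmUpto_div`). [cite: LaiSprangZudilin2026, §5 (eq:PNT)] -/
theorem eventually_lcmUpto_le_exp {η : ℝ} (hη : 0 < η) :
    ∀ᶠ n : ℕ in atTop, (Nat.lcmUpto n : ℝ) ≤ Real.exp ((1 + η) * n) := by
  have h := Literature.NumberTheory.Transcendental.tendsto_log_lcmUpto_div.eventually
    (Iio_mem_nhds (show (1 : ℝ) < 1 + η by linarith))
  filter_upwards [h, eventually_gt_atTop 0] with n hn hn0
  have hpos : (0 : ℝ) < Nat.lcmUpto n := by exact_mod_cast Nat.lcmUpto_pos n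
  have hn0' : (0 : ℝ) < n := by exact_mod_cast hn0
  rw [← Real.log_le_iff_le_exp hpos]
  have hn' : Real.log (Nat.lcmUpto n) / n < 1 + η := hn
  rw [div_lt_iff₀ hn0'] at hn'
  exact hn'.le

/-- `θ(n) ≥ (1−η)n` eventually (prime number theorem; tree: `chebyshevTheta_isEquivalent`). [cite: LaiSprangZudilin2026, §5 (eq:PNT)] -/
theorem eventually_theta_ge {η : ℝ} (hη : 0 < η) :
    ∀ᶠ n : ℕ in atTop, (1 - η) * n ≤ Chebyshev.theta n := by
  have hz : ∀ᶠ x : ℝ in atTop, (fun x : ℝ => x) x ≠ 0 := by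
    filter_upwards [eventually_gt_atTop 0] with x hx using hx.ne'
  have ht : Tendsto (fun x : ℝ => Chebyshev.theta x / x) atTop (𝓝 1) :=
    (isEquivalent_iff_tendsto_one hz).mp Literature.NumberTheory.LFunctions.chebyshevTheta_isEquivalent
  have h := (ht.comp tendsto_natCast_atTop_atTop).eventually (Ioi_mem_nhds (show 1 - η < (1 : ℝ) by linarith))
  filter_upwards [h, eventually_gt_atTop 0] with n hn hn0
  have hn0' : (0 : ℝ) < n := by exact_mod_cast hn0
  have hn' : 1 - η < Chebyshev.theta n / n := hn
  rw [lt_div_iff₀ hn0'] at hn'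
  exact hn'.le

/-- `M_n = max{3, ⌊√(2n)⌋}`: the primes excluded from `Π_n` are those `≤ M_n`. [cite: LaiSprangZudilin2026, Lemma 5.4 (`Π_n`)] -/
def sqBound (n : ℕ) : ℕ := max 3 (Nat.sqrt (2 * n))

/-- `∏_{p ≤ n} p ≤ Π_n · 4^{M_n}` (the excluded primes are `≤ M_n`, and `∏_{p ≤ M} p ≤ 4^M`).
[cite: LaiSprangZudilin2026, Lemma 5.4 (`Π_n`), §5 (eq:PNT)] -/
theorem primorial_le_primeProd_mul (n : ℕ) : primorial n ≤ primeProd n * 4 ^ sqBound n := by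
  set P := (range (n + 1)).filter Nat.Prime with hP
  have h1 : primeProd n = ∏ p ∈ P.filter (fun p => 3 < p ∧ 2 * n < p ^ 2), p := by
    unfold primeProd
    refine Finset.prod_congr ?_ fun _ _ => rfl
    ext p
    simp only [Finset.mem_filter, Finset.mem_range, hP, and_assoc]
  have h2 : (∏ p ∈ P.filter (fun p => ¬(3 < p ∧ 2 * n < p ^ 2)), p) ≤ primorial (sqBound n) := by
    unfold primorial
    refine Finset.prod_le_prod_of_subset_of_one_le' (fun p hp => ?_) (fun p hp _ => ?_)
    · simp only [Finset.mem_filter, Finset.mem_range, hP, not_and_or, not_lt] at hp ⊢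
      obtain ⟨⟨-, hpr⟩, hq⟩ := hp
      refine ⟨?_, hpr⟩
      rcases hq with h3 | hsq
      · have : 3 ≤ sqBound n := le_max_left _ _
        omega
      · have hps : p ≤ Nat.sqrt (2 * n) := Nat.le_sqrt.2 (by nlinarith [hsq])
        have : Nat.sqrt (2 * n) ≤ sqBound n := le_max_right _ _
        omega
    · exact (Finset.mem_filter.1 hp).2.one_lt.le
  calc primorial n = ∏ p ∈ P, p := rfl
    _ = (∏ p ∈ P.filter (fun p => 3 < p ∧ 2 * n < p ^ 2), p) * ∏ p ∈ P.filter (fun p => ¬(3 < p ∧ 2 * n < p ^ 2)), p :=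
        (Finset.prod_filter_mul_prod_filter_not P _ _).symm
    _ ≤ primeProd n * 4 ^ sqBound n := by
        rw [← h1]
        exact Nat.mul_le_mul_left _ (h2.trans (primorial_le_four_pow _))

/-- `M_n log 4 ≤ c·n` eventually, for every `c > 0` (`M_n = O(√n)`). [folklore] -/
private theorem eventually_sqBound_mul_log_le {c : ℝ} (hc : 0 < c) :
    ∀ᶠ n : ℕ in atTop, (sqBound n : ℝ) * Real.log 4 ≤ c * n := by
  have hl4 : 0 < Real.log 4 := Real.log_pos (by norm_num)
  set t : ℝ := 4 * Real.log 4 / c with ht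
  have ht0 : 0 < t := by positivity
  filter_upwards [tendsto_natCast_atTop_atTop.eventually_ge_atTop ((3 * Real.log 4 + t / 2 * Real.log 4) * 2 / c)]
    with n hn
  have hs : ((Nat.sqrt (2 * n) : ℕ) : ℝ) ^ 2 ≤ 2 * n := by
    exact_mod_cast Nat.sqrt_le' (2 * n)
  have hsb : (sqBound n : ℝ) ≤ 3 + ((Nat.sqrt (2 * n) : ℕ) : ℝ) := by
    have : sqBound n ≤ 3 + Nat.sqrt (2 * n) := max_le (by omega) (by omega)
    exact_mod_cast this
  set s : ℝ := ((Nat.sqrt (2 * n) : ℕ) : ℝ) with hsdef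
  have hs0 : 0 ≤ s := Nat.cast_nonneg _
  have hs' : s ≤ n / t + t / 2 := by
    have h1 : 2 * s * t ≤ 2 * n + t ^ 2 := by nlinarith [sq_nonneg (s - t), hs]
    rw [div_add_div _ _ ht0.ne' two_ne_zero, le_div_iff₀ (by positivity)]
    nlinarith [h1]
  have e : (n : ℝ) / t * Real.log 4 = c / 4 * n := by
    rw [ht]
    field_simp
  have hn' := (div_le_iff₀ hc).1 hn
  have hcn : 0 ≤ c * n := by positivity
  calc (sqBound n : ℝ) * Real.log 4 ≤ (3 + s) * Real.log 4 := mul_le_mul_of_nonneg_right hsb hl4.le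
    _ ≤ (3 + (n / t + t / 2)) * Real.log 4 := by gcongr
    _ = 3 * Real.log 4 + t / 2 * Real.log 4 + n / t * Real.log 4 := by ring
    _ ≤ c * n := by rw [e]; nlinarith [hn', hcn]

/-- **`Π_n ≥ e^{(1−η)n}` eventually** (`Π_n = e^{n+o(n)}`, prime number theorem). [cite: LaiSprangZudilin2026, §5 (eq:PNT)] -/
theorem eventually_exp_le_primeProd {η : ℝ} (hη : 0 < η) :
    ∀ᶠ n : ℕ in atTop, Real.exp ((1 - η) * n) ≤ primeProd n := by
  filter_upwards [eventually_theta_ge (half_pos hη), eventually_sqBound_mul_log_le (half_pos hη)] with n hθ hM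
  have hprim : (primorial n : ℝ) ≤ primeProd n * (4 : ℝ) ^ sqBound n := by
    exact_mod_cast primorial_le_primeProd_mul n
  have hθ' : Chebyshev.theta n = Real.log (primorial n) := by
    rw [Chebyshev.theta_eq_log_primorial, Nat.floor_natCast]
  have h4 : (4 : ℝ) ^ sqBound n = Real.exp (sqBound n * Real.log 4) := by
    rw [Real.exp_nat_mul, Real.exp_log (by norm_num)]
  have hp0 : (0 : ℝ) < primorial n := by exact_mod_cast primorial_pos n
  have h40 : (0 : ℝ) < (4 : ℝ) ^ sqBound n := by positivity
  calc Real.exp ((1 - η) * n) ≤ Real.exp ((1 - η / 2) * n - sqBound n * Real.log 4) :=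
        Real.exp_le_exp.2 (by linarith)
    _ = Real.exp ((1 - η / 2) * n) / (4 : ℝ) ^ sqBound n := by rw [Real.exp_sub, h4]
    _ ≤ (primorial n : ℝ) / (4 : ℝ) ^ sqBound n := by
        gcongr
        rw [← Real.exp_log hp0, Real.exp_le_exp, ← hθ']
        exact hθ
    _ ≤ primeProd n := by rw [div_le_iff₀ h40]; exact hprim

/-- **`Π_n ∣ d_n`** (`Π_n` is a product of distinct primes `≤ n`). [cite: LaiSprangZudilin2026, Lemma 5.4 (`Π_n`)] -/
theorem primeProd_dvd_lcmUpto (n : ℕ) : primeProd n ∣ Nat.lcmUpto n := by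
  unfold primeProd
  refine Finset.prod_primes_dvd _ (fun p hp => ((Finset.mem_filter.1 hp).2.1).prime) (fun p hp => ?_)
  obtain ⟨hpr, hpp, -⟩ := Finset.mem_filter.1 hp
  unfold Nat.lcmUpto
  exact Finset.dvd_lcm (Finset.mem_Icc.2 ⟨hpp.one_lt.le, by simpa [Nat.lt_succ_iff] using hpr⟩)

/-! ## §3. §7: `a_n`, `b_n` and Bel's criterion -/

/-- `Π_n^{−1} d_n^6 ∈ ℕ`. [cite: LaiSprangZudilin2026, §7 (proof of Thm 1.1: "`Ŝ_n := Π_n^{−1}d_n^6·S_n`")] -/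
def dPi (n : ℕ) : ℕ := Nat.lcmUpto n ^ 6 / primeProd n

/-- `Π_n ∣ d_n^6`. [cite: LaiSprangZudilin2026, §7 (proof of Thm 1.1)] -/
theorem primeProd_dvd_lcmUpto_pow (n : ℕ) : primeProd n ∣ Nat.lcmUpto n ^ 6 :=
  (primeProd_dvd_lcmUpto n).trans (dvd_pow_self _ (by norm_num))

/-- `dPi n = d_n^6/Π_n` in `ℚ`. [cite: LaiSprangZudilin2026, §7 (proof of Thm 1.1)] -/
theorem dPi_cast_rat (n : ℕ) : (dPi n : ℚ) = (Nat.lcmUpto n : ℚ) ^ 6 / primeProd n := by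
  rw [dPi, Nat.cast_div (primeProd_dvd_lcmUpto_pow n) (by exact_mod_cast primeProd_ne_zero n), Nat.cast_pow]

/-- `dPi n = d_n^6/Π_n` in `ℝ`. [cite: LaiSprangZudilin2026, §7 (proof of Thm 1.1)] -/
theorem dPi_cast_real (n : ℕ) : (dPi n : ℝ) = (Nat.lcmUpto n : ℝ) ^ 6 / primeProd n := by
  rw [dPi, Nat.cast_div (primeProd_dvd_lcmUpto_pow n) (by exact_mod_cast primeProd_ne_zero n), Nat.cast_pow]

/-- `dPi n ≥ 1`. [cite: LaiSprangZudilin2026, §7 (proof of Thm 1.1)] -/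
theorem dPi_pos (n : ℕ) : 0 < dPi n :=
  Nat.div_pos (Nat.le_of_dvd (pow_pos (Nat.lcmUpto_pos n) 6) (primeProd_dvd_lcmUpto_pow n))
    (Nat.pos_of_ne_zero (primeProd_ne_zero n))

/-- **`Π_n^{−1}d_n^6 ≤ e^{(5+ε)n}` eventually** ("`d_n^6/Π_n = e^{5n+o(n)}`" by (eq:PNT)). [cite: LaiSprangZudilin2026, §5 (eq:PNT), §7] -/
theorem eventually_dPi_le_exp {ε : ℝ} (hε : 0 < ε) :
    ∀ᶠ n : ℕ in atTop, (dPi n : ℝ) ≤ Real.exp ((5 + ε) * n) := by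
  have hη : 0 < ε / 7 := by positivity
  filter_upwards [eventually_lcmUpto_le_exp hη, eventually_exp_le_primeProd hη] with n hd hP
  have hP0 : (0 : ℝ) < primeProd n := by exact_mod_cast Nat.pos_of_ne_zero (primeProd_ne_zero n)
  rw [dPi_cast_real, div_le_iff₀ hP0]
  calc (Nat.lcmUpto n : ℝ) ^ 6 ≤ Real.exp ((1 + ε / 7) * n) ^ 6 := pow_le_pow_left₀ (by positivity) hd 6
    _ = Real.exp ((5 + ε) * n) * Real.exp ((1 - ε / 7) * n) := by
        rw [← Real.exp_nat_mul, ← Real.exp_add]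
        congr 1
        push_cast
        ring
    _ ≤ Real.exp ((5 + ε) * n) * primeProd n := mul_le_mul_of_nonneg_left hP (Real.exp_pos _).le

/-- `Ŝ`-coefficients as rationals: `a_n = Π_n^{−1}d_n^6·ρ_{n,0}`. [cite: LaiSprangZudilin2026, §7 (proof of Thm 1.1, `a_n`)] -/
def qa (n : ℕ) : ℚ := (dPi n : ℚ) * rho0 n

/-- `b_n = Π_n^{−1}d_n^6·ρ_{n,3}`. [cite: LaiSprangZudilin2026, §7 (proof of Thm 1.1, `b_n`)] -/
def qb (n : ℕ) : ℚ := (dPi n : ℚ) * rho3 n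

/-- `a_n ∈ ℤ` (Lemma 5.4; `a_0 = 0`). [cite: LaiSprangZudilin2026, §7 (proof of Thm 1.1), Lemma 5.4] -/
theorem exists_int_qa (n : ℕ) : ∃ z : ℤ, qa n = z := by
  rcases Nat.eq_zero_or_pos n with rfl | hn
  · exact ⟨0, by simp [qa, rho0]⟩
  · obtain ⟨z, hz⟩ := lemma54 hn
    exact ⟨z, by rw [qa, dPi_cast_rat]; exact hz⟩

/-- `b_n ∈ ℤ` (`ρ_{n,3} ∈ ℤ`). [cite: LaiSprangZudilin2026, §7 (proof of Thm 1.1), Lemma 5.1] -/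
theorem exists_int_qb (n : ℕ) : ∃ z : ℤ, qb n = z := by
  obtain ⟨z, hz⟩ := exists_int_rho3 n
  exact ⟨dPi n * z, by rw [qb, hz]; push_cast; ring⟩

/-- **`a_n ∈ ℤ`** as an integer sequence. [cite: LaiSprangZudilin2026, §7 (proof of Thm 1.1, `a_n`)] -/
def aSeq (n : ℕ) : ℤ := (qa n).num

/-- **`b_n ∈ ℤ`** as an integer sequence. [cite: LaiSprangZudilin2026, §7 (proof of Thm 1.1, `b_n`)] -/
def bSeq (n : ℕ) : ℤ := (qb n).num

/-- `a_n = Π_n^{−1}d_n^6·ρ_{n,0}` in `ℚ`. [cite: LaiSprangZudilin2026, §7 (proof of Thm 1.1)] -/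
theorem aSeq_cast (n : ℕ) : (aSeq n : ℚ) = (dPi n : ℚ) * rho0 n := by
  obtain ⟨z, hz⟩ := exists_int_qa n
  rw [aSeq, ← qa, hz, Rat.num_intCast]

/-- `b_n = Π_n^{−1}d_n^6·ρ_{n,3}` in `ℚ`. [cite: LaiSprangZudilin2026, §7 (proof of Thm 1.1)] -/
theorem bSeq_cast (n : ℕ) : (bSeq n : ℚ) = (dPi n : ℚ) * rho3 n := by
  obtain ⟨z, hz⟩ := exists_int_qb n
  rw [bSeq, ← qb, hz, Rat.num_intCast]

/-- **`Ŝ_n = Π_n^{−1}d_n^6·S_n = a_n + b_nζ₂(5)`** (Lemma 3.3 times `Π_n^{−1}d_n^6`). [cite: LaiSprangZudilin2026, §7 (proof of Thm 1.1)] -/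
theorem linearForm_eq (n : ℕ) :
    (aSeq n : ℚ_[2]) + (bSeq n : ℚ_[2]) * padicZetaValue 2 5 = ((dPi n : ℕ) : ℚ_[2]) * S n := by
  have ha : (aSeq n : ℚ_[2]) = ((dPi n : ℕ) : ℚ_[2]) * ((rho0 n : ℚ) : ℚ_[2]) := by
    rw [← Rat.cast_intCast, aSeq_cast]; push_cast; ring
  have hb : (bSeq n : ℚ_[2]) = ((dPi n : ℕ) : ℚ_[2]) * ((rho3 n : ℚ) : ℚ_[2]) := by
    rw [← Rat.cast_intCast, bSeq_cast]; push_cast; ring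
  rw [ha, hb, lemma33]
  ring

/-- **`a_nb_{n+1} − a_{n+1}b_n ≠ 0`** (Lemma 4.2 (b) = `determinant_ne_zero`, and `Π_n^{−1}d_n^6 ≠ 0`).
[cite: LaiSprangZudilin2026, §7 (proof of Thm 1.1), Lemma 4.2 (b)] -/
theorem det_ne_zero (n : ℕ) : aSeq n * bSeq (n + 1) - aSeq (n + 1) * bSeq n ≠ 0 := by
  have h : ((aSeq n * bSeq (n + 1) - aSeq (n + 1) * bSeq n : ℤ) : ℚ) ≠ 0 := by
    push_cast
    rw [aSeq_cast, aSeq_cast, bSeq_cast, bSeq_cast]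
    have e : (dPi n : ℚ) * rho0 n * ((dPi (n + 1) : ℚ) * rho3 (n + 1)) - (dPi (n + 1) : ℚ) * rho0 (n + 1) * ((dPi n : ℚ) * rho3 n) =
        (dPi n : ℚ) * dPi (n + 1) * (rho0 n * rho3 (n + 1) - rho0 (n + 1) * rho3 n) := by ring
    rw [e]
    refine mul_ne_zero (mul_ne_zero ?_ ?_) (determinant_ne_zero n)
    · exact_mod_cast (dPi_pos n).ne'
    · exact_mod_cast (dPi_pos (n + 1)).ne'
  exact_mod_cast h

/-- **`|Ŝ_n|₂ ≤ exp(−(α−ε)n)`**, `α = 16 log 2` (Lemma 6.2 and `|Π_n^{−1}d_n^6|₂ ≤ 1`). [cite: LaiSprangZudilin2026, §7 (proof of Thm 1.1), Lemma 6.2] -/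
theorem eventually_norm_linearForm_le {ε : ℝ} (hε : 0 < ε) :
    ∀ᶠ n : ℕ in atTop, ‖(aSeq n : ℚ_[2]) + bSeq n * padicZetaValue 2 5‖ ≤ Real.exp (-(16 * Real.log 2 - ε) * n) := by
  filter_upwards [norm_S_le_exp hε] with n hn
  rw [linearForm_eq, norm_mul]
  have h1 : ‖((dPi n : ℕ) : ℚ_[2])‖ ≤ 1 := by
    have h := Padic.norm_int_le_one (p := 2) ((dPi n : ℕ) : ℤ)
    rwa [Int.cast_natCast] at h
  calc ‖((dPi n : ℕ) : ℚ_[2])‖ * ‖S n‖ ≤ 1 * ‖S n‖ := mul_le_mul_of_nonneg_right h1 (norm_nonneg _)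
    _ = ‖S n‖ := one_mul _
    _ ≤ Real.exp (-(16 * Real.log 2 - ε) * n) := hn

/-- `|a_n| = Π_n^{−1}d_n^6·|ρ_{n,0}|` in `ℝ`. [cite: LaiSprangZudilin2026, §7 (proof of Thm 1.1)] -/
theorem abs_aSeq_real (n : ℕ) : |(aSeq n : ℝ)| = (dPi n : ℝ) * |(recSol 0 (-1024) n : ℝ)| := by
  have h : (aSeq n : ℝ) = ((dPi n : ℚ) * rho0 n : ℚ) := by rw [← aSeq_cast]; push_cast; rfl
  rw [h]
  push_cast
  rw [abs_mul, abs_of_nonneg (by positivity), rho0]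

/-- `|b_n| = 768·Π_n^{−1}d_n^6·|ρ_n|` in `ℝ`. [cite: LaiSprangZudilin2026, §7 (proof of Thm 1.1), Lemma 5.2] -/
theorem abs_bSeq_real (n : ℕ) : |(bSeq n : ℝ)| = 768 * (dPi n : ℝ) * |(recSol 1 96 n : ℝ)| := by
  have h : (bSeq n : ℝ) = ((dPi n : ℚ) * rho3 n : ℚ) := by rw [← bSeq_cast]; push_cast; rfl
  rw [h, rho3, rhoQ]
  push_cast
  rw [abs_mul, abs_mul, abs_of_nonneg (by positivity : (0 : ℝ) ≤ dPi n), abs_of_nonneg (by norm_num : (0 : ℝ) ≤ 768)]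
  ring

/-- **`max{|a_n|, |b_n|} ≤ exp((β+ε)n)`**, `β = 8 log 2 + 5` (Lemma 6.1 and (eq:PNT)). [cite: LaiSprangZudilin2026, §7 (proof of Thm 1.1)] -/
theorem eventually_max_abs_le {ε : ℝ} (hε : 0 < ε) :
    ∀ᶠ n : ℕ in atTop, max |(aSeq n : ℝ)| |(bSeq n : ℝ)| ≤ Real.exp ((8 * Real.log 2 + 5 + ε) * n) := by
  have hε3 : 0 < ε / 3 := by positivity
  have h768 : ∀ᶠ n : ℕ in atTop, (768 : ℝ) ≤ Real.exp (ε / 3 * n) :=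
    (Real.tendsto_exp_atTop.comp ((tendsto_natCast_atTop_atTop (R := ℝ)).const_mul_atTop hε3)).eventually_ge_atTop 768
  filter_upwards [eventually_dPi_le_exp hε3, eventually_abs_recSol_le_exp 0 (-1024) hε3,
    eventually_abs_recSol_le_exp 1 96 hε3, h768] with n hd h0 h1 h7
  have hD0 : (0 : ℝ) ≤ dPi n := by positivity
  have e : Real.exp ((8 * Real.log 2 + 5 + ε) * n) =
      Real.exp (ε / 3 * n) * Real.exp ((5 + ε / 3) * n) * Real.exp ((8 * Real.log 2 + ε / 3) * n) := by
    rw [← Real.exp_add, ← Real.exp_add]; congr 1; ring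
  have h1le : (1 : ℝ) ≤ Real.exp (ε / 3 * n) := Real.one_le_exp (by positivity)
  refine max_le ?_ ?_
  · rw [abs_aSeq_real, e]
    calc (dPi n : ℝ) * |(recSol 0 (-1024) n : ℝ)| ≤ Real.exp ((5 + ε / 3) * n) * Real.exp ((8 * Real.log 2 + ε / 3) * n) :=
          mul_le_mul hd h0 (abs_nonneg _) (Real.exp_pos _).le
      _ = 1 * (Real.exp ((5 + ε / 3) * n) * Real.exp ((8 * Real.log 2 + ε / 3) * n)) := (one_mul _).symm
      _ ≤ Real.exp (ε / 3 * n) * (Real.exp ((5 + ε / 3) * n) * Real.exp ((8 * Real.log 2 + ε / 3) * n)) :=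
          mul_le_mul_of_nonneg_right h1le (by positivity)
      _ = _ := by ring
  · rw [abs_bSeq_real, e]
    calc 768 * (dPi n : ℝ) * |(recSol 1 96 n : ℝ)|
          = 768 * ((dPi n : ℝ) * |(recSol 1 96 n : ℝ)|) := by ring
      _ ≤ Real.exp (ε / 3 * n) * (Real.exp ((5 + ε / 3) * n) * Real.exp ((8 * Real.log 2 + ε / 3) * n)) :=
          mul_le_mul h7 (mul_le_mul hd h1 (abs_nonneg _) (Real.exp_pos _).le) (by positivity) (Real.exp_pos _).le
      _ = _ := by ring

end Literature.NumberTheory.Irrationality.LaiSprangZudilin2026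

namespace Literature.NumberTheory.Irrationality.PAdicZetaValues

open Literature.NumberTheory.Irrationality.LaiSprangZudilin2026

/-- **Lai–Sprang–Zudilin 2026, Theorem 1.1 — DISCHARGED**: `ζ₂(5)` is irrational and `μ(ζ₂(5)) ≤ 16 log 2/(8 log 2 − 5)`.
The printed §7: Bel's criterion (`MeasureCriterion.bel_criterion` = Lemma 2.3) applied to `a_n = Π_n^{−1}d_n^6ρ_{n,0}`,
`b_n = Π_n^{−1}d_n^6ρ_{n,3}` with `α = 16 log 2` (Lemma 6.2), `β = 8 log 2 + 5` (Lemma 6.1, (eq:PNT)), `a_nb_{n+1} − a_{n+1}b_n ≠ 0`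
(Lemma 4.2 (b)). [cite: LaiSprangZudilin2026, Thm 1.1 and §7] -/
theorem laiSprangZudilin2026_theorem11_holds : laiSprangZudilin2026_theorem11 := by
  have hlog2 := Real.log_two_gt_d9
  have hβ : (0 : ℝ) < 8 * Real.log 2 + 5 := by linarith
  have hαβ : 8 * Real.log 2 + 5 < 16 * Real.log 2 := by linarith
  have e : (8 : ℝ) * Real.log 2 - 5 = 16 * Real.log 2 - (8 * Real.log 2 + 5) := by ring
  unfold laiSprangZudilin2026_theorem11
  rw [e]
  exact MeasureCriterion.bel_criterion 2 (padicZetaValue 2 5) hβ hαβ aSeq bSeq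
    (fun ε hε => eventually_norm_linearForm_le hε) (fun ε hε => eventually_max_abs_le hε) det_ne_zero

end Literature.NumberTheory.Irrationality.PAdicZetaValues
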